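import Literature.MathematicalPhysics.QuantumFieldTheory.Balaban1983to89.B3Ineq210ZeroTorus
import Literature.MathematicalPhysics.QuantumFieldTheory.Balaban1983to89.B3Sect3VectorSelfEnergy

/-!
# `Balaban1983to89.B3Ineq210MixedTorus` — T. Bałaban, *(Higgs)₂,₃ quantum fields in a finite volume. III. Renormalization*, Commun.
Math. Phys. **88** (1983) 411–445 [Balaban1983Higgs3], (2.10) p. 426: the clause *"and if the propagator is differentiated, then for
each differentiation, there is an additional factor (L^jη)^{−1} on the right side"* with ONE DIFFERENTIATION IN EACH VARIABLE — the
twice-differentiated kernels `(∂^η_μ G^η_{(j)} ∂^{η*}_ν)(x,x′)` of (3.9)/(3.16)/(3.26) — PROVED for the TORUS MODEL INSTANCE `A = B̃ = 0`,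
`Ω = T_η` of p03's `B3Ineq210ZeroTorus` (pieces `pieceT`), hypothesis-free and uniformly in the volume and the scale:
`η^{−d}|(∂^η_μG^η_{(j)}∂^{η*}_ν)(x,x′)| ≤ C(L^jη)^{−d}e^{−δ₁(L^jη)^{−1}|x−x′|}`

statement-level skeleton of published theorems with citation tags; proofs where landed; nothing here is a claim about the Yang–Mills mass gap

PDF held: `paper:balaban1983-higgs-2-3-quantum-fields-finite-volume` (journal page = PDF page + 410); p. 426 [PDF 16] read in the OCR text
and on the render `run/shared/lean/pub/pub-balaban/b2b-balaban-ref1/pages/1983-cmp88-higgs23-III/1983-cmp88-higgs23-III-p016-x2.png`; [B4] =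
T. Bałaban, *Regularity and decay of lattice Green's functions*, CMP **89** (1983) [Balaban1983RegularityDecay], (2.34)–(2.38) p. 582, as
quoted by `B4Thm110ZeroTorus`.

CITATION HEADER (lean-in-tree rule).  Part of the lit-balaban TYPED SKELETON (HOME `run/shared/lean/pub/lit-balaban/`), Phase 2, seat p20
generation 5: SKELETON row **B3.Eq2.10** (`HOME/lit-balaban-r15/ROWS-B3.md`, fold owner r15).  COMPLEMENT of p03 g4's `B3Ineq210ZeroTorus`
(p258063: the VALUE and single-DERIVATIVE clauses of (2.10) for the same pieces on the same torus — not restated) written by the CONSUMER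
side: the §3 files take exactly these twice-differentiated kernels as hypotheses (r15's `B3Sect3ScalarSelfEnergy.dKernel` in (3.9)
`coeff39` and (3.16) `bracket316`, `B3Sect3VectorSelfEnergy.d2Kernel` in (3.26) `kerC`; p20's `B3Ineq313Pointwise.abs_term312_le` (hGj),
`B3Bound316Cxi.abs_bracket316_CxiT_le` (hM), `B3Ineq326Curly.abs_curly2_le` (hB′)).  A thin assembly over p38 g4's `B4Thm110ZeroTorus`
(`term_eq_rescaled`, `QkGrs_apply`, `derivGrsQks_apply`, the three-kernel convolution `conv_bound`, the kernel inputs `KerBounds` /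
`kerBounds_torus`), p39 g5's `B3GkZeroTorusPointwise.exp_block_le`, p37/p16's `B5Leaf237C0Torus.G0unit_decay` and p03's pieces; nothing
of these is re-proved.

WHAT IS PRINTED (p. 426 [PDF 16], verbatim): *"For the propagators G^η_{(j)} we apply the inequality |G^η_{(j)}(Ω, B̃; x, x′)| ≤
O(1)(L^jη)^{−d+2}e^{−δ₁(L^jη)^{−1}|x−x′|}, (2.10) and if the propagator is differentiated, then for each differentiation, there is an
additional factor (L^jη)^{−1} on the right side."*  Two differentiations (one in `x` — `∂^η_μ` from the left — and one in `x′` —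
`∂^{η*}_ν` from the right, B3 (3.9) *"q(∂^η_μG_{(j)}(0)∂^{η*}_μ)(x,x′)q"*) give the degree `−d`.

WHAT IS TYPED / PROVED, and how.  §1 `mixedT s μ ν G = ∂^s_μ·G·(∂^s_ν)ᵀ` (matrices on the fine torus `Site P 0`; `B1RG242Torus.deriv` =
the forward difference quotient) with its entry formula `mixedT_apply` = `s^{−2}[G(x+e_μ,x′+e_ν) − G(x+e_μ,x′) − G(x,x′+e_ν) + G(x,x′)]` =
r15's `d2Kernel s⁻¹ μ ν G x x′` (`mixedT_eq_d2Kernel`; `dKernel` for `ν = μ`).  §2 the `j = 0` piece `G^ε_1 = ε²G_0^{unit}`: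
`mixedT ε (G^ε_1) = mixedT 1 G_0^{unit}` (`mixedT_G_one`) and the second difference of an exponentially decaying kernel decays at the same rate
(`abs_mixedT_one_le_of_decay`, factor `4e^{2δ₀}`).  §3 the `1 ≤ j < k` pieces: `mixedT_term_apply` — the printed kernel `K1_j` of [B4]
(2.35) appears on BOTH ends, `(∂_μ term_j ∂_νᵀ)(x,x′) = a_j²L^{−jd}Σ_{y,y′}K1_j(μ;x,y)C^{(j)}(y,y′)K1_j(ν;x′,y′)` (the two powers `(L^jε)²`
of `term_j` are exactly eaten by the two derivatives), hence by `conv_bound` and `exp_block_le` the bound `abs_mixedPieceT_le_of` at one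
volume under the kernel inputs: `η^{−d}|mixedT_{μν}(pieceT j)(x,x′)| ≤ (4C₀e^{2δ₀} + a²C³K_d(δ/2)²e^δ)·((L^jη)^d)^{−1}·
e^{−min(δ₀,δ/2)|x−x′|_T/L^j}`.  §4 **`ineq210_mixed_zeroTorus`**: for `d ≥ 1`, odd `L > 1`, `a > 0`, `m² ≥ 0` there are `δ₁, C > 0` such that
for EVERY volume `P` with these `d, L`, every scale `1 ≤ k ≤ K`, all `j, μ, ν, x, x′`:
`η^{−d}|mixedT_{μν}(pieceT j)(x,x′)| ≤ C·((L^jη)^d)^{−1}·e^{−δ₁(L^jη)^{−1}(η|x−x′|_T)}` (also with the real power `(L^jη)^{−d}`,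
`ineq210_mixed_zeroTorus_rpow`), + a witness volume.  HONEST SCOPE = that of `B3Ineq210ZeroTorus` (A = B̃ = 0, U ≡ 1, Ω = the whole torus,
sup torus distance `T` in fine units, fixed `a > 0`, `m² ≥ 0`, existential constants).  D-0026: no named fact (`mixedT` is a `def` with
body); standard axioms.  Unit `lit-balaban-p20` (literature-prover-lit-balaban-p20-g5-0), 2026-08-21.
-/

namespace Literature.MathematicalPhysics.QuantumFieldTheory.Balaban1983to89.B3Ineq210MixedTorus

open Matrix B1RG242Torus B5Display136Torus B5Leaf237C0Torus B4Ineq115Torus B5Ineq137Torus B4Ineq116Torus B4Thm110ZeroTorus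
open B3GkZeroTorusPointwise (exp_block_le)
open B3Ineq210ZeroTorus

noncomputable section

variable (P : Params)

/-! ## §1 The twice-differentiated kernel `∂_μ G ∂_νᵀ` -/

/-- The kernel differentiated once in each variable, as a matrix on the fine torus: `∂^s_μ · G · (∂^s_ν)ᵀ` (forward difference
quotients `B1RG242Torus.deriv` of step `s`; the transpose acting on the column variable = `∂^{s*}_ν` acting from the right, B3 (3.9)).
[cite: Balaban1983Higgs3, (2.10) p.426] -/
def mixedT (s : ℝ) (μ ν : Fin P.d) (G : Matrix (Site P 0) (Site P 0) ℝ) : Matrix (Site P 0) (Site P 0) ℝ :=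
  deriv P 0 s μ * G * (deriv P 0 s ν)ᵀ

variable {P}

/-- kernel: a right transposed derivative differentiates the column variable, `(M·(∂^s_ν)ᵀ)(y,x′) = s⁻¹(M(y,x′+e_ν) − M(y,x′))`. [folklore] -/
private theorem mul_deriv_transpose_apply {ι : Type*} (s : ℝ) (ν : Fin P.d) (M : Matrix ι (Site P 0) ℝ) (y : ι)
    (x' : Site P 0) : (M * (deriv P 0 s ν)ᵀ) y x' = s⁻¹ * (M y (Site.shift x' ν) - M y x') := by
  rw [show M * (deriv P 0 s ν)ᵀ = (deriv P 0 s ν * Mᵀ)ᵀ by rw [Matrix.transpose_mul, Matrix.transpose_transpose],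
    Matrix.transpose_apply, B5Leaf235Torus.deriv_mul_apply]
  rfl

/-- The entry formula: `(∂_μG∂_νᵀ)(x,x′) = s⁻¹·s⁻¹·[G(x+e_μ,x′+e_ν) − G(x+e_μ,x′) − G(x,x′+e_ν) + G(x,x′)]`.
[cite: Balaban1983Higgs3, (2.10) p.426] -/
theorem mixedT_apply (s : ℝ) (μ ν : Fin P.d) (G : Matrix (Site P 0) (Site P 0) ℝ) (x x' : Site P 0) :
    mixedT P s μ ν G x x' = s⁻¹ * s⁻¹ *
      (G (Site.shift x μ) (Site.shift x' ν) - G (Site.shift x μ) x' - G x (Site.shift x' ν) + G x x') := by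
  unfold mixedT
  rw [Matrix.mul_assoc, B5Leaf235Torus.deriv_mul_apply, mul_deriv_transpose_apply, mul_deriv_transpose_apply]
  ring

/-- The twice-differentiated kernel IS r15's (3.26) kernel notation `(∂^η_μG∂^{η*}_ν)(x,x′)` = `B3Sect3VectorSelfEnergy.d2Kernel` with
`c = s⁻¹` (same torus `Site P 0`, same shifts). [cite: Balaban1983Higgs3, (2.10) p.426, (3.26) p.440] -/
theorem mixedT_eq_d2Kernel (s : ℝ) (μ ν : Fin P.d) (G : Matrix (Site P 0) (Site P 0) ℝ) (x x' : Site P 0) :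
    mixedT P s μ ν G x x' = B3Sect3VectorSelfEnergy.d2Kernel s⁻¹ μ ν G x x' := by
  rw [mixedT_apply, B3Sect3VectorSelfEnergy.d2Kernel, pow_two]

/-- … and for `ν = μ` it is r15's (3.9) kernel `(∂^η_μG∂^{η*}_μ)(x,x′)` = `B3Sect3ScalarSelfEnergy.dKernel`. [cite: Balaban1983Higgs3, (2.10) p.426, (3.9) p.435] -/
theorem mixedT_eq_dKernel (s : ℝ) (μ : Fin P.d) (G : Matrix (Site P 0) (Site P 0) ℝ) (x x' : Site P 0) :
    mixedT P s μ μ G x x' = B3Sect3ScalarSelfEnergy.dKernel s⁻¹ μ G x x' := by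
  rw [mixedT_apply, B3Sect3ScalarSelfEnergy.dKernel, pow_two]

/-- kernel: `mixedT` of the zero kernel vanishes. [folklore] -/
private theorem mixedT_zero (s : ℝ) (μ ν : Fin P.d) : mixedT P s μ ν 0 = 0 := by
  unfold mixedT; rw [Matrix.mul_zero, Matrix.zero_mul]

/-! ## §2 The `j = 0` piece: the second difference of `G_0^{unit}` -/

section Zero

variable {a msq : ℝ}

/-- The two `ε`-derivatives eat the factor `ε²` of `G^ε_1 = ε²G_0^{unit}`: `∂^ε_μ G^ε_1 (∂^ε_ν)ᵀ = ∂¹_μ G_0^{unit} (∂¹_ν)ᵀ` entrywise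
(`B5Display136Torus.G_one_eq_smul_G0unit`). [cite: Balaban1983RegularityDecay, (2.34) p.582 at `j = 0`; Balaban1983Higgs3, (2.10) p.426] -/
theorem mixedT_G_one (ha : 0 < a) (hm : 0 ≤ msq) (μ ν : Fin P.d) (x x' : Site P 0) :
    mixedT P P.eps μ ν ((tower P a msq).G 1) x x' = mixedT P 1 μ ν (G0unit P a msq) x x' := by
  have hε : P.eps ≠ 0 := P.eps_pos.ne'
  rw [mixedT_apply, mixedT_apply, G_one_eq_smul_G0unit (P := P) ha hm]
  simp only [Matrix.smul_apply, smul_eq_mul, inv_one, one_mul]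
  field_simp

/-- kernel: a shift of either argument changes the torus distance by at most one. [folklore] -/
private theorem T_shift_shift_ge (μ ν : Fin P.d) (x x' : Site P 0) :
    T P 0 x x' - 2 ≤ T P 0 (Site.shift x μ) (Site.shift x' ν) ∧
      T P 0 x x' - 1 ≤ T P 0 (Site.shift x μ) x' ∧ T P 0 x x' - 1 ≤ T P 0 x (Site.shift x' ν) := by
  have h1 := T_shift_le_one P x μ
  have h2 := T_shift_le_one P x' ν
  have t1 := T_triangle P 0 x (Site.shift x μ) x'
  have t2 := T_triangle P 0 (Site.shift x μ) (Site.shift x' ν) x'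
  have t3 := T_symm P 0 (Site.shift x' ν) x'
  have t4 := T_triangle P 0 x (Site.shift x' ν) x'
  have t5 := T_triangle P 0 x (Site.shift x μ) (Site.shift x' ν)
  refine ⟨by linarith, by linarith, by linarith⟩

/-- The second difference of an exponentially decaying kernel decays at the same rate: if `|G(x,x′)| ≤ C₀e^{−δ₀|x−x′|_T}` then
`|(∂¹_μG∂¹ᵀ_ν)(x,x′)| ≤ 4C₀e^{2δ₀}e^{−δ₀|x−x′|_T}` (unit steps move the points by ≤ 1; the `j = 0` input of (2.10) twice differentiated).
[cite: Balaban1983RegularityDecay, (2.37) p.582 at `j = 0`; Balaban1983Higgs3, (2.10) p.426] -/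
theorem abs_mixedT_one_le_of_decay {G : Matrix (Site P 0) (Site P 0) ℝ} {C₀ δ₀ : ℝ} (hC₀ : 0 ≤ C₀) (hδ₀ : 0 < δ₀)
    (hG : ∀ x x' : Site P 0, |G x x'| ≤ C₀ * Real.exp (-(δ₀ * T P 0 x x'))) (μ ν : Fin P.d) (x x' : Site P 0) :
    |mixedT P 1 μ ν G x x'| ≤ 4 * C₀ * Real.exp (2 * δ₀) * Real.exp (-(δ₀ * T P 0 x x')) := by
  rw [mixedT_apply, inv_one, one_mul, one_mul]
  obtain ⟨g1, g2, g3⟩ := T_shift_shift_ge μ ν x x'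
  set E : ℝ := Real.exp (2 * δ₀) * Real.exp (-(δ₀ * T P 0 x x')) with hE
  have key : ∀ u v : Site P 0, T P 0 x x' - 2 ≤ T P 0 u v → |G u v| ≤ C₀ * E := by
    intro u v huv
    refine (hG u v).trans (mul_le_mul_of_nonneg_left ?_ hC₀)
    rw [hE, ← Real.exp_add]
    exact Real.exp_le_exp.mpr (by nlinarith)
  have e1 := key (Site.shift x μ) (Site.shift x' ν) g1
  have e2 := key (Site.shift x μ) x' (by linarith [g2])
  have e3 := key x (Site.shift x' ν) (by linarith [g3])
  have e4 := key x x' (by linarith)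
  calc |G (Site.shift x μ) (Site.shift x' ν) - G (Site.shift x μ) x' - G x (Site.shift x' ν) + G x x'|
      ≤ |G (Site.shift x μ) (Site.shift x' ν)| + |G (Site.shift x μ) x'| + |G x (Site.shift x' ν)| + |G x x'| := by
        have := abs_sub (G (Site.shift x μ) (Site.shift x' ν) - G (Site.shift x μ) x') (G x (Site.shift x' ν))
        have := abs_sub (G (Site.shift x μ) (Site.shift x' ν)) (G (Site.shift x μ) x')
        have := abs_add_le (G (Site.shift x μ) (Site.shift x' ν) - G (Site.shift x μ) x' - G x (Site.shift x' ν)) (G x x')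
        linarith
    _ ≤ C₀ * E + C₀ * E + C₀ * E + C₀ * E := by linarith
    _ = 4 * C₀ * Real.exp (2 * δ₀) * Real.exp (-(δ₀ * T P 0 x x')) := by rw [hE]; ring

end Zero

/-! ## §3 The `1 ≤ j < k` pieces: `K1_j` on both ends -/

section Term

variable {a msq : ℝ}

/-- **The entry of a twice-differentiated term of (2.34)**: the kernel `K1_j = ∂^{L^{−j}}G_j^{resc}Q_j^*` of [B4] (2.35) appears on BOTH
ends — `(∂^ε_μ term_j (∂^ε_ν)ᵀ)(x,x′) = a_j²·L^{−jd}·Σ_{y,y′} K1_j(μ;x,y) C^{(j)}(y,y′) K1_j(ν;x′,y′)` (the two factors `(L^jε)` of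
`term_j = a_j²(L^jε)²·G^{resc}Q^*C^{(j)}QG^{resc}` are consumed by the two derivatives; `(Q_jG_j^{resc})ᵀ = L^{−jd}G_j^{resc}Q_j^*`,
`B4Thm110ZeroTorus.QkGrs_apply`). [cite: Balaban1983RegularityDecay, (2.34)–(2.35) p.582; Balaban1983Higgs3, (2.10) p.426] -/
theorem mixedT_term_apply (ha : 0 < a) (hm : 0 ≤ msq) {j : ℕ} (hj1 : 1 ≤ j) (hj : j ≤ P.m + P.K) (μ ν : Fin P.d)
    (x x' : Site P 0) :
    mixedT P P.eps μ ν ((tower P a msq).term j) x x' = B1.aSeq a P.L j ^ 2 * (((P.L : ℝ) ^ j) ^ P.d)⁻¹ *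
      ∑ y : Site P j, ∑ y' : Site P j,
        K1 P a msq j μ x ⟨j, y⟩ * Crs P a msq j y y' * K1 P a msq j ν x' ⟨j, y'⟩ := by
  have hs : P.spacing j ≠ 0 := (P.spacing_pos j).ne'
  have hL : (deriv P 0 P.eps μ * Grs P a msq j * Qks P j) x = fun y => (P.spacing j)⁻¹ * K1 P a msq j μ x ⟨j, y⟩ :=
    funext fun y => derivGrsQks_apply P ha hm hj1 μ x y
  have hR : ∀ y' : Site P j, (Qk P j * Grs P a msq j * (deriv P 0 P.eps ν)ᵀ) y' x' =
      (((P.L : ℝ) ^ j) ^ P.d)⁻¹ * ((P.spacing j)⁻¹ * K1 P a msq j ν x' ⟨j, y'⟩) := by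
    intro y'
    rw [mul_deriv_transpose_apply, QkGrs_apply P hj, QkGrs_apply P hj, ← derivGrsQks_apply P ha hm hj1 ν x' y',
      Matrix.mul_assoc (deriv P 0 P.eps ν), B5Leaf235Torus.deriv_mul_apply]
    ring
  unfold mixedT
  rw [term_eq_rescaled P ha hm hj1, Matrix.mul_smul, Matrix.smul_mul, Matrix.smul_apply, smul_eq_mul,
    show deriv P 0 P.eps μ * (Grs P a msq j * Qks P j * Crs P a msq j * (Qk P j * Grs P a msq j)) * (deriv P 0 P.eps ν)ᵀ
      = (deriv P 0 P.eps μ * Grs P a msq j * Qks P j) * Crs P a msq j * (Qk P j * Grs P a msq j * (deriv P 0 P.eps ν)ᵀ) by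
        simp only [Matrix.mul_assoc],
    triple_apply, hL]
  simp_rw [hR]
  rw [Finset.mul_sum, Finset.mul_sum]
  refine Finset.sum_congr rfl fun y _ => ?_
  rw [Finset.mul_sum, Finset.mul_sum]
  refine Finset.sum_congr rfl fun y' _ => ?_
  field_simp

/-- kernel: the scale factors — `ε^{−d}·L^{−jd} = ((L^jε)^d)^{−1}`. [folklore] -/
private theorem eps_weight_zero (j : ℕ) :
    (P.eps ^ P.d)⁻¹ * (((P.L : ℝ) ^ j) ^ P.d)⁻¹ = (P.spacing j ^ P.d)⁻¹ := by
  unfold Params.spacing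
  rw [mul_pow ((P.L : ℝ) ^ j) P.eps P.d, mul_inv, mul_comm]

/-- **(2.10), MIXED CLAUSE (one derivative in each variable), piecewise, at one volume under the kernel inputs** (`KerBounds`: [B4]
(2.35), (2.37) on the torus; `hG0`: the `C^{(0)}` kernel bound): in the print's `η^d`-normalisation,
`η^{−d}|(∂^η_μG^η_{(j)}∂^{η*}_ν)(x,x′)| ≤ (4C₀e^{2δ₀} + a²C³K_d(δ/2)²e^δ)·((L^jη)^d)^{−1}·e^{−min(δ₀,δ/2)|x−x′|_T/L^j}` for every `j`, all
directions and all fine sites — the printed `O(1)(L^jη)^{−d}e^{−δ₁(L^jη)^{−1}|x−x′|}` (two factors `(L^jη)^{−1}` off the value clause).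
[cite: Balaban1983Higgs3, (2.10) p.426] -/
theorem abs_mixedPieceT_le_of (ha : 0 < a) (hm : 0 ≤ msq) {k : ℕ} (hkm : k ≤ P.m + P.K) {C δ C₀ δ₀ : ℝ}
    (hC : 0 ≤ C) (hδ : 0 < δ) (hC₀ : 0 ≤ C₀) (hδ₀ : 0 < δ₀) (hK : KerBounds P a msq k C δ)
    (hG0 : ∀ x x' : Site P 0, |G0unit P a msq x x'| ≤ C₀ * Real.exp (-(δ₀ * T P 0 x x')))
    (j : ℕ) (μ ν : Fin P.d) (x x' : Site P 0) :
    (P.eps ^ P.d)⁻¹ * |mixedT P P.eps μ ν (pieceT P a msq k j) x x'|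
      ≤ (4 * C₀ * Real.exp (2 * δ₀) + a ^ 2 * (C ^ 3 * B4Sect5Proof.latticeConst P.d (δ / 2) ^ 2 * Real.exp δ))
          * (P.spacing j ^ P.d)⁻¹
          * Real.exp (-(min δ₀ (δ / 2) * (T P 0 x x' / (P.L : ℝ) ^ j))) := by
  have hε := P.eps_pos
  have hεd : 0 < (P.eps ^ P.d)⁻¹ := by positivity
  have hT := T_nonneg P 0 x x'
  have hmid : 0 ≤ a ^ 2 * (C ^ 3 * B4Sect5Proof.latticeConst P.d (δ / 2) ^ 2 * Real.exp δ) := by positivity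
  have hzero : 0 ≤ 4 * C₀ * Real.exp (2 * δ₀) := by positivity
  have hsw : 0 ≤ (P.spacing j ^ P.d)⁻¹ := by have := P.spacing_pos j; positivity
  rcases Nat.eq_zero_or_pos j with rfl | hj1
  · -- `j = 0`: the second difference of `G_0^{unit}`
    rw [pieceT_zero, mixedT_G_one ha hm, pow_zero, div_one, P.spacing_zero]
    have h := abs_mixedT_one_le_of_decay hC₀ hδ₀ hG0 μ ν x x'
    have hexp : Real.exp (-(δ₀ * T P 0 x x')) ≤ Real.exp (-(min δ₀ (δ / 2) * T P 0 x x')) :=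
      Real.exp_le_exp.2 (by nlinarith [min_le_left δ₀ (δ / 2)])
    calc (P.eps ^ P.d)⁻¹ * |mixedT P 1 μ ν (G0unit P a msq) x x'|
        ≤ (P.eps ^ P.d)⁻¹ * (4 * C₀ * Real.exp (2 * δ₀) * Real.exp (-(min δ₀ (δ / 2) * T P 0 x x'))) :=
          mul_le_mul_of_nonneg_left (h.trans (mul_le_mul_of_nonneg_left hexp hzero)) hεd.le
      _ = 4 * C₀ * Real.exp (2 * δ₀) * (P.eps ^ P.d)⁻¹ * Real.exp (-(min δ₀ (δ / 2) * T P 0 x x')) := by ring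
      _ ≤ _ := by
          refine mul_le_mul_of_nonneg_right (mul_le_mul_of_nonneg_right (by linarith) hεd.le) (Real.exp_pos _).le
  · rcases Nat.lt_or_ge j k with hjk | hkj
    · -- `1 ≤ j < k`: `K1_j` on both ends
      have hj : j ≤ P.m + P.K := hjk.le.trans hkm
      rw [pieceT_of_pos hj1 hjk, mixedT_term_apply ha hm hj1 hj, abs_mul, abs_of_nonneg (by positivity)]
      have hconv := conv_bound P hδ hC hC hC (Site.proj j j x) (Site.proj j j x')
        (fun y => K1 P a msq j μ x ⟨j, y⟩) (Crs P a msq j) (fun y' => K1 P a msq j ν x' ⟨j, y'⟩)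
        (hK.k1 j hj1 hjk μ x) (hK.crs j hj1 hjk) (hK.k1 j hj1 hjk ν x')
      have hblk := exp_block_le P hj (show 0 ≤ δ / 2 by positivity) x x'
      rw [show 2 * (δ / 2) = δ from by ring] at hblk
      have haj : B1.aSeq a P.L j ^ 2 ≤ a ^ 2 :=
        pow_le_pow_left₀ (B1.aSeq_pos ha (one_lt_cast_L P) hj1).le (B1.aSeq_le ha (one_lt_cast_L P) j hj1) 2
      have hexp : Real.exp (-(δ / 2 * T P 0 x x' / (P.L : ℝ) ^ j))
          ≤ Real.exp (-(min δ₀ (δ / 2) * (T P 0 x x' / (P.L : ℝ) ^ j))) := by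
        rw [mul_div_assoc]
        exact Real.exp_le_exp.2 (by
          have : 0 ≤ T P 0 x x' / (P.L : ℝ) ^ j := div_nonneg hT (pow_pos P.cast_L_pos j).le
          nlinarith [min_le_right δ₀ (δ / 2)])
      have hw : 0 ≤ (((P.L : ℝ) ^ j) ^ P.d)⁻¹ := by positivity
      calc (P.eps ^ P.d)⁻¹ * (B1.aSeq a P.L j ^ 2 * (((P.L : ℝ) ^ j) ^ P.d)⁻¹ *
            |∑ y : Site P j, ∑ y' : Site P j,
              K1 P a msq j μ x ⟨j, y⟩ * Crs P a msq j y y' * K1 P a msq j ν x' ⟨j, y'⟩|)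
          ≤ (P.eps ^ P.d)⁻¹ * (a ^ 2 * (((P.L : ℝ) ^ j) ^ P.d)⁻¹ *
              (C * C * C * B4Sect5Proof.latticeConst P.d (δ / 2) ^ 2 *
                (Real.exp δ * Real.exp (-(δ / 2 * T P 0 x x' / (P.L : ℝ) ^ j))))) := by
            refine mul_le_mul_of_nonneg_left ?_ hεd.le
            refine mul_le_mul (mul_le_mul_of_nonneg_right haj hw)
              (hconv.trans (mul_le_mul_of_nonneg_left hblk (by positivity))) (abs_nonneg _) (by positivity)
        _ = a ^ 2 * (C ^ 3 * B4Sect5Proof.latticeConst P.d (δ / 2) ^ 2 * Real.exp δ) *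
              ((P.eps ^ P.d)⁻¹ * (((P.L : ℝ) ^ j) ^ P.d)⁻¹) *
              Real.exp (-(δ / 2 * T P 0 x x' / (P.L : ℝ) ^ j)) := by ring
        _ = a ^ 2 * (C ^ 3 * B4Sect5Proof.latticeConst P.d (δ / 2) ^ 2 * Real.exp δ) *
              (P.spacing j ^ P.d)⁻¹ * Real.exp (-(δ / 2 * T P 0 x x' / (P.L : ℝ) ^ j)) := by rw [eps_weight_zero]
        _ ≤ a ^ 2 * (C ^ 3 * B4Sect5Proof.latticeConst P.d (δ / 2) ^ 2 * Real.exp δ) *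
              (P.spacing j ^ P.d)⁻¹ * Real.exp (-(min δ₀ (δ / 2) * (T P 0 x x' / (P.L : ℝ) ^ j))) :=
            mul_le_mul_of_nonneg_left hexp (mul_nonneg hmid hsw)
        _ ≤ _ := by
            refine mul_le_mul_of_nonneg_right (mul_le_mul_of_nonneg_right (by linarith) hsw) (Real.exp_pos _).le
    · -- `j ≥ k`: no piece
      rw [pieceT_of_le hj1 hkj, mixedT_zero, Matrix.zero_apply, abs_zero, mul_zero]
      positivity

end Term

/-! ## §4 The mixed clause of (2.10), hypothesis-free and volume-uniform -/

/-- kernel: `(L^jη)^{−1}·(η|x−x′|_T) = |x−x′|_T/L^j`. [folklore] -/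
private theorem scale_inv_mul_dist' (j : ℕ) (x x' : Site P 0) :
    (P.spacing j)⁻¹ * (P.eps * T P 0 x x') = T P 0 x x' / (P.L : ℝ) ^ j := by
  unfold Params.spacing
  rw [mul_inv, mul_assoc, ← mul_assoc (P.eps)⁻¹, inv_mul_cancel₀ P.eps_pos.ne', one_mul, div_eq_inv_mul]

/-- **B3 (2.10) p. 426, THE TWICE-DIFFERENTIATED CLAUSE, PROVED FOR THE TORUS MODEL INSTANCE `A = B̃ = 0`, `Ω = T_η`, hypothesis-free and
uniform in the volume and the scale**: for `d ≥ 1`, odd `L > 1`, `a > 0`, `m² ≥ 0` there are `δ₁ > 0`, `C > 0` (functions of `d, L, a,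
m²`) such that for EVERY volume `P = (d, L, m, K)` of Bałaban's scalar torus tower, every scale `1 ≤ k ≤ K` (`G_k(T_η,0) = G^ε_k`,
`η = ε`), all `j`, `μ, ν`, `x, x′ ∈ T_η`: `η^{−d}|(∂^η_μ G^η_{(j)} ∂^{η*}_ν)(x,x′)| ≤ C·((L^jη)^d)^{−1}·e^{−δ₁(L^jη)^{−1}|x−x′|}` with
`|x − x′| = η|x−x′|_T` — the print's *"for each differentiation … an additional factor (L^jη)^{−1}"* applied twice to (2.10), i.e. the degree
`−d` kernels `(∂^η_μG_{(j)}(0)∂^{η*}_μ)(x,x′)` of (3.9)/(3.16) and `(∂^η_{μ′}G∂^{η*}_μ)` of (3.26).  Route: [B4] (2.34) on the torus with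
the kernel `K1_j` of (2.35) on both ends (`mixedT_term_apply`), Lemma 2.4 on the torus (`B4Thm110ZeroTorus.kerBounds_torus`), the
three-kernel convolution `conv_bound`, and the `C^{(0)}` kernel (`B5Leaf237C0Torus.G0unit_decay`) twice differenced.
[cite: Balaban1983Higgs3, (2.10) p.426] -/
theorem ineq210_mixed_zeroTorus (d L : ℕ) (hd : 1 ≤ d) (hL : Odd L ∧ 1 < L) {a : ℝ} (ha : 0 < a) {msq : ℝ}
    (hmsq : 0 ≤ msq) :
    ∃ δ₁ C : ℝ, 0 < δ₁ ∧ 0 < C ∧ ∀ (P : Params), P.d = d → P.L = L →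
      ∀ k : ℕ, 1 ≤ k → k ≤ P.K → ∀ (j : ℕ) (μ ν : Fin P.d) (x x' : Site P 0),
        (P.eps ^ P.d)⁻¹ * |mixedT P P.eps μ ν (pieceT P a msq k j) x x'| ≤
          C * (P.spacing j ^ P.d)⁻¹ * Real.exp (-(δ₁ * (P.spacing j)⁻¹ * (P.eps * T P 0 x x'))) := by
  obtain ⟨C, δ, hC, hδ, hK⟩ := kerBounds_torus d L hd hL ha msq
  obtain ⟨P₀, hP₀d, hP₀L⟩ : ∃ P₀ : Params, P₀.d = d ∧ P₀.L = L := ⟨⟨d, L, 0, 0, hd, hL⟩, rfl, rfl⟩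
  set C₀ := 2 / gamma0 L a with hC₀def
  set δ₀ := dK0 d L a msq with hδ₀def
  have hC₀ : 0 ≤ C₀ := by
    rw [hC₀def, ← hP₀L]; exact (div_pos two_pos (gamma0_pos (P := P₀) ha)).le
  have hδ₀ : 0 < δ₀ := by rw [hδ₀def, ← hP₀d, ← hP₀L]; exact dK0_pos (P := P₀) ha hmsq
  refine ⟨min δ₀ (δ / 2),
    4 * C₀ * Real.exp (2 * δ₀) + a ^ 2 * (C ^ 3 * B4Sect5Proof.latticeConst d (δ / 2) ^ 2 * Real.exp δ) + 1,
    lt_min hδ₀ (by positivity), by positivity, ?_⟩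
  intro P hPd hPL k _ hkK j μ ν x x'
  have hkm : k ≤ P.m + P.K := hkK.trans (Nat.le_add_left _ _)
  have hcap : P.spacing k ^ 2 * msq ≤ msq := by
    have hs1 : P.spacing k ≤ 1 := by rw [← P.spacing_K]; exact spacing_le_spacing P hkK
    have hs0 := (P.spacing_pos k).le
    calc P.spacing k ^ 2 * msq ≤ 1 * msq := mul_le_mul_of_nonneg_right (pow_le_one₀ hs0 hs1) hmsq
      _ = msq := one_mul _
  have hKB := hK P hPd hPL msq hmsq k hkm hcap
  subst hPd hPL
  have hG0 : ∀ x x' : Site P 0, |G0unit P a msq x x'| ≤ C₀ * Real.exp (-(δ₀ * T P 0 x x')) :=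
    fun x x' => G0unit_decay (P := P) ha hmsq x x'
  have hsw : 0 ≤ (P.spacing j ^ P.d)⁻¹ := by have := P.spacing_pos j; positivity
  rw [mul_assoc (min δ₀ (δ / 2)) ((P.spacing j)⁻¹), scale_inv_mul_dist']
  refine (abs_mixedPieceT_le_of ha hmsq hkm hC hδ hC₀ hδ₀ hKB hG0 j μ ν x x').trans ?_
  refine mul_le_mul_of_nonneg_right (mul_le_mul_of_nonneg_right (by linarith) hsw) (Real.exp_pos _).le

/-- The same with the real power `(L^jη)^{−d}` — the shape of the hypotheses `C₁·s^{−d}·e^{−δs^{−1}|x−x′|}` of the §3 consumers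
(`B3Ineq313Pointwise.abs_term312_le` etc.). [cite: Balaban1983Higgs3, (2.10) p.426] -/
theorem ineq210_mixed_zeroTorus_rpow (d L : ℕ) (hd : 1 ≤ d) (hL : Odd L ∧ 1 < L) {a : ℝ} (ha : 0 < a) {msq : ℝ}
    (hmsq : 0 ≤ msq) :
    ∃ δ₁ C : ℝ, 0 < δ₁ ∧ 0 < C ∧ ∀ (P : Params), P.d = d → P.L = L →
      ∀ k : ℕ, 1 ≤ k → k ≤ P.K → ∀ (j : ℕ) (μ ν : Fin P.d) (x x' : Site P 0),
        (P.eps ^ P.d)⁻¹ * |mixedT P P.eps μ ν (pieceT P a msq k j) x x'| ≤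
          C * P.spacing j ^ (-(P.d : ℝ)) * Real.exp (-(δ₁ * (P.spacing j)⁻¹ * (P.eps * T P 0 x x'))) := by
  obtain ⟨δ₁, C, hδ₁, hC, h⟩ := ineq210_mixed_zeroTorus d L hd hL ha hmsq
  refine ⟨δ₁, C, hδ₁, hC, fun P hPd hPL k hk1 hkK j μ ν x x' => ?_⟩
  rw [Real.rpow_neg (P.spacing_pos j).le, Real.rpow_natCast]
  exact h P hPd hPL k hk1 hkK j μ ν x x'

/-! ## §5 Non-vacuity: the binders are inhabited (`d = 3`, `L = 3`, `a = 1`, `m² = 0`; the volume `m = K = 1`, scale `k = 1`) -/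

/-- The constants exist and the mixed clause holds for an explicit torus volume. [cite: Balaban1983Higgs3, (2.10) p.426] -/
theorem ineq210_mixed_zeroTorus_witness :
    ∃ δ₁ C : ℝ, 0 < δ₁ ∧ 0 < C ∧
      let P : Params := ⟨3, 3, 1, 1, by norm_num, ⟨⟨1, by norm_num⟩, by norm_num⟩⟩
      ∀ (j : ℕ) (μ ν : Fin P.d) (x x' : Site P 0),
        (P.eps ^ P.d)⁻¹ * |mixedT P P.eps μ ν (pieceT P 1 0 1 j) x x'| ≤
          C * (P.spacing j ^ P.d)⁻¹ * Real.exp (-(δ₁ * (P.spacing j)⁻¹ * (P.eps * T P 0 x x'))) := by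
  obtain ⟨δ₁, C, hδ₁, hC, h⟩ :=
    ineq210_mixed_zeroTorus 3 3 (by norm_num) ⟨⟨1, by norm_num⟩, by norm_num⟩ (a := 1) one_pos (msq := 0) le_rfl
  exact ⟨δ₁, C, hδ₁, hC, h _ rfl rfl 1 le_rfl le_rfl⟩

end

end Literature.MathematicalPhysics.QuantumFieldTheory.Balaban1983to89.B3Ineq210MixedTorus
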